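import Summits.HubbardSuperconductivity.HubbardSuperconductivity.Theorems.AbsenceCertificateSourcedOrderDominatesLRO
import Summits.HubbardSuperconductivity.HubbardSuperconductivity.Theorems.NoGoNogoThesis
import Literature.MathematicalPhysics.QuantumLattice.PairCorrelationsProofs

/-!
# Route `AbsenceCertificate`: the schema `SourcedVanishingExcludesLRO`

Support item `stmt-HubbardSuperconductivity-10350` of route `HubbardSuperconductivity/AbsenceCertificate`
(the schema in the deciding chain `closes : SourcedVanishingExcludesLRO → UniversalSourcedVanishing →
¬HubbardSuperconductivity`): for every `U > 0` and `δ ∈ (0, 1/2)`, if some chemical potential `μ`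
canonically supports `(U, δ)` and the finite-volume Koma–Tasaki `d`-wave order parameter vanishes there
(`∀ η > 0 ∃ h₀ > 0 ∀ h ∈ (0,h₀) ∃ L₀ ∀ L ≥ L₀, dWaveSourceDensity L U μ h ≤ η`), then NOT every admissible
sequence of normalised `(N_L, S^z = 0)`-sector ground states of `hubbardTorus 2 L 1 U`
(`N_L = 2⌊(1-δ)L²/2⌋`) has `d_{x²-y²}` pair-field long-range order along even sides.

Proof (as planned in the route file): an admissible all-sides sequence exists
(`exists_groundStateInSector_seq`); if it had even-side LRO, the normal form
`torusLROSeq_pairFieldCorr_succ` of the box-averaged pair correlation and `0 < liminf` give an eventual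
floor `a·L⁴ ≤ Re⟨ψ_L, Δ_d†Δ_d ψ_L⟩` (`a > 0`) along even `L`; the engine
`sourcedOrderDominatesLRO_proof` (item 9486, Kaplan–Horsch–von der Linden / Koma–Tasaki) then gives
`dWaveSourceDensity L U μ h ≥ √(a/2)/2` for every `h > 0` at all large even `L`, contradicting the
vanishing clause at `η = √(a/2)/4`. The barrier module `PureModelStripeCompetition` is NOT imported (route
instruction); the conclusion is the summit matrix inlined, as in the item. No definition is introduced.
-/

set_option linter.dupNamespace false

noncomputable section

namespace Summit.HubbardSuperconductivity.HubbardSuperconductivity.Theorems.AbsenceCertificate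

open Matrix Filter Literature.MathematicalPhysics.QuantumLattice Literature.Probability.LatticeModels
open Summit.HubbardSuperconductivity.HubbardSuperconductivity.Theses.AbsenceCertificate
open Summit.HubbardSuperconductivity.HubbardSuperconductivity.Theorems
open Summit.HubbardSuperconductivity.NoGo (exists_groundStateInSector_seq pairFieldSeq_nonneg)
open scoped ComplexOrder

/-- **Even-side LRO in floor form.** If the pulled-back `d`-wave pair correlation of a family `ψ` has
long-range order along even sides (the summit's `HasLongRangeOrder` clause), then for some `a > 0`,
`a·L⁴ ≤ Re⟨ψ_L, Δ_d†Δ_d ψ_L⟩` for all large even `L` (normal form `torusLROSeq_pairFieldCorr_succ`: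
the `k`-th term of the LRO sequence is `(2k)⁻⁴ Re⟨ψ_{2k}, Δ_d†Δ_d ψ_{2k}⟩`, and a positive `liminf` of
a sequence bounded below by `0` is eventually undercut by half of itself). Friedli–Velenik (2017)
§3.7.2 (LRO as a `liminf`); Scalapino, Phys. Rep. 250 (1995) 329, §2. [folklore] -/
theorem kt_eventual_floor_of_evenLRO (ψ : ∀ L, Fock (Orb (FermionTorus 2 L)))
    (hLRO : HasLongRangeOrder (fun k => halfOpenBox 2 (2 * k))
      (fun k => torusPullback (pairFieldCorr dWaveFormFactor ψ) (2 * k))) :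
    ∃ a : ℝ, 0 < a ∧ ∃ L₀ : ℕ, ∀ (L : ℕ) [NeZero L], Even L → L₀ ≤ L →
      a * (L : ℝ) ^ 4 ≤
        (expect ((pairField dWaveFormFactor L)ᴴ * pairField dWaveFormFactor L) (ψ L)).re := by
  unfold HasLongRangeOrder at hLRO
  rw [← Filter.liminf_nat_add _ 1] at hLRO
  have key : ∀ k : ℕ,
      (∑ x ∈ halfOpenBox 2 (2 * (k + 1)), ∑ y ∈ halfOpenBox 2 (2 * (k + 1)),
          torusPullback (pairFieldCorr dWaveFormFactor ψ) (2 * (k + 1)) x y) /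
        ((halfOpenBox 2 (2 * (k + 1))).card : ℝ) ^ 2 =
      (expect ((pairField dWaveFormFactor (2 * k + 1 + 1))ᴴ * pairField dWaveFormFactor (2 * k + 1 + 1))
          (ψ (2 * k + 1 + 1))).re / ((2 * k + 1 + 1 : ℕ) : ℝ) ^ 4 := by
    intro k
    rw [show 2 * (k + 1) = 2 * k + 1 + 1 by ring]
    exact torusLROSeq_pairFieldCorr_succ dWaveFormFactor ψ (2 * k + 1)
  simp only [key] at hLRO
  obtain ⟨a, ha0, hal⟩ := exists_between hLRO
  have hev := Filter.eventually_lt_of_lt_liminf hal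
    (isBoundedUnder_of ⟨0, fun k => pairFieldSeq_nonneg dWaveFormFactor ψ (2 * k + 1)⟩)
  obtain ⟨K₀, hK₀⟩ := Filter.eventually_atTop.1 hev
  refine ⟨a, ha0, 2 * K₀ + 2, fun L _ hLeven hL => ?_⟩
  obtain ⟨j, hj⟩ := hLeven
  obtain ⟨k, rfl⟩ : ∃ k, L = 2 * k + 1 + 1 := ⟨j - 1, by omega⟩
  have hk : K₀ ≤ k := by omega
  have h := hK₀ k hk
  rw [lt_div_iff₀ (by positivity)] at h
  exact h.le

/-- **`SourcedVanishingExcludesLRO` holds** (route `AbsenceCertificate`, support item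
`stmt-HubbardSuperconductivity-10350`): canonical support of `(U, δ)` by `μ` together with the vanishing
of the sourced `d`-wave order parameter at `μ` excludes the summit's matrix at `(U, δ)` — some (in fact
every) admissible `(N_L, S^z=0)`-sector ground-state sequence fails to have `d_{x²-y²}` pair-field LRO
along even sides. From the engine `sourcedOrderDominatesLRO_proof` (LRO ⇒ sourced order,
Kaplan–Horsch–von der Linden 1989 / Koma–Tasaki 1994 Thm 2.2) applied to the admissible sequence of
`exists_groundStateInSector_seq`. [cite: KomaTasaki1994, Theorem 2.2] -/
theorem sourcedVanishingExcludesLRO_proof : SourcedVanishingExcludesLRO := by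
  intro U _hU δ hδ hμ hall
  obtain ⟨μ, hsup, hvan⟩ := hμ
  -- an admissible all-sides sequence of normalised sector ground states
  obtain ⟨N, ψ, hNψ⟩ := exists_groundStateInSector_seq 1 U δ (by linarith [hδ.1])
  have hLRO := hall N ψ fun L _ => hNψ L
  -- its LRO in floor form
  obtain ⟨a, ha, L₀, hfloor⟩ := kt_eventual_floor_of_evenLRO ψ hLRO
  -- the engine
  have hψ' : ∀ L, Even L → star (ψ L) ⬝ᵥ ψ L = 1 ∧
      IsGroundStateInSector (hubbardTorus 2 L 1 U) (N L) 0 (ψ L) :=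
    fun L _ => ⟨(hNψ L).2.1, (hNψ L).2.2⟩
  have hsup' : ∀ ε : ℝ, 0 < ε → ∃ L₀ : ℕ, ∀ L : ℕ, Even L → L₀ ≤ L →
      |(hubbardTorus 2 L 1 U).minEnergyOn (szSector (N L) 0) - μ * (N L : ℝ) -
        Matrix.groundEnergy (hubbardTorusWith 2 L 1 U μ)| ≤ ε * (L : ℝ) ^ 2 := by
    intro ε hε
    obtain ⟨L₁, hL₁⟩ := hsup ε hε
    refine ⟨L₁, fun L hLe hL => ?_⟩
    rw [(hNψ L).1]
    exact hL₁ L hLe hL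
  have heng := sourcedOrderDominatesLRO_proof U μ N ψ hψ' hsup' a ha ⟨L₀, fun L _ hLe hL => hfloor L hLe hL⟩
  -- the vanishing clause at `η = √(a/2)/4`, source `h₀/2`
  have hsq : 0 < Real.sqrt (a / 2) := Real.sqrt_pos.2 (by positivity)
  obtain ⟨h₀, hh₀, hvan'⟩ := hvan (Real.sqrt (a / 2) / 4) (by positivity)
  obtain ⟨L₁, hL₁⟩ := hvan' (h₀ / 2) ⟨by linarith, by linarith⟩
  obtain ⟨L₂, hL₂⟩ := heng (h₀ / 2) (by linarith) (Real.sqrt (a / 2) / 2) (by positivity)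
  -- a large even side
  haveI : NeZero (2 * (L₁ + L₂ + 1)) := ⟨by omega⟩
  have h1 := hL₁ (2 * (L₁ + L₂ + 1)) (by omega)
  have h2 := hL₂ (2 * (L₁ + L₂ + 1)) ⟨L₁ + L₂ + 1, by ring⟩ (by omega)
  linarith

end Summit.HubbardSuperconductivity.HubbardSuperconductivity.Theorems.AbsenceCertificate

end
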